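import Summits.Ventures.YMGap.RobustBall.StarNeumann
import Summits.Ventures.YMGap.Thresholds.StarWindowBoundWeight
import HarnessLib

/-!
# Venture YMGap, track ROBUST-BALL (Y2) — crux Y2-X2 for the FULL tier-1 ball, step 3a: the ROBUST
# Lemma-G ARRAY `Krob = Karr c + U` on the torus star of `(ℤ/L)^d`

HONEST FRAMING. WHAT THIS IS: a venture file (cell `pub-ymgap`, track Y2 ROBUST-BALL, seat ds-2); finite
combinatorics of the discrete torus and real arithmetic, NO measure, NO kernel estimate, NO number. For a
per-incidence coefficient `c ≥ 0` and an OFF-COLUMN array `E x z ≥ 0` (the cross-Lipschitz entries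
`√N · ℓ(x, z)` of a tier-1 member whose polymers are larger than a plaquette — the open part of crux Y2-X2;
for plaquette-local members `E = 0` and everything below is ds-4's Lemma G), the robust influence matrix is
`Cst c E x z = c · tInfluence x z + E x z`. This file defines the ROBUST STAR ARRAY
`Krob c E θ K s y x = Karr c s y x + Uarr c E θ K s y x` — ds-4's Lemma-G array PLUS the Neumann-iterate
super-solution (`StarNeumann.superSol`, depth `K`, in-star row bound `θ`) of the in-star matrix applied to the
source `wsrc c E s y x = E x y + ∑_{z ∈ ⋆∖x} E x z · Karr c s y z` — and proves its bookkeeping: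
nonnegativity, support (`Krob ≠ 0 ⇒ y` on the star boundary or `E · y ≠ 0` from the star), the in-star row
bound `∑_{z ∈ ⋆∖x} Cst ≤ (2d−2)c + λ`, the domination `c · kside ≤ 2 Karr`, and the AVERAGING LEMMA
(the mean of the two one-sided Neumann corrections is below `Uarr`). The comparison theorem using it is
`RobustStarWindow.lean`; the received sum is `RobustStarReceivedSum.lean`.
WHAT THIS IS NOT: no specification, no clustering statement; lattice strong-coupling bookkeeping only —
nothing about the continuum or the Millennium problem.

## References
* H. Föllmer, LNM 1362 (1988) Ch. I (2.8)–(2.10); R. L. Dobrushin, S. B. Shlosman (1985).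
* The tree: `Thresholds/StarLemmaGArrayDim.lean`, `StarLemmaGSuperSolutionDim.lean` (ds-4), `StarNeumann.lean`.
-/

noncomputable section

open Finset Function
open Literature.MathematicalPhysics.QuantumFieldTheory
open Literature.MathematicalPhysics.QuantumFieldTheory.Balaban1983to89.StrongCouplingTorusWindow
open Summit.Ventures.YMGap.DSWindow
open Summit.Ventures.YMGap.StarKernel
open Summit.Ventures.YMGap.StarResolventDim (Delta gaugeR)
open Summit.Ventures.YMGap.StarLemmaGDim
open Summit.Ventures.YMGap.StarNeumann

namespace Summit.Ventures.YMGap.RobustStar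

variable {d L : ℕ} [NeZero L]

/-! ### The in-star Wilson row: `∑_{z ∈ ⋆∖x} tInfluence x z ≤ 2d − 2` -/

/-- **In-star plaquette row.** A star link `x` shares a plaquette with every star link of a different
direction and none with its opposite: `∑_{z ∈ ⋆ ∖ x} tInfluence x z ≤ 2d − 2` (side `≥ 3`). [folklore] -/
theorem sum_star_erase_tInfluence_le (hL : 3 ≤ L) {s : Site d L} {x : Edge d L} (hx : x ∈ vertexStar s) :
    ∑ z ∈ (vertexStar s).erase x, (tInfluence x z : ℝ) ≤ 2 * (d : ℝ) - 2 := by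
  have hL1 : 1 < L := by omega
  -- the opposite link `a` of `x` (same direction, other orientation)
  obtain ⟨o, hxo⟩ := eq_starLink_of_mem_vertexStar hx
  set a : Edge d L := starLink s x.2 (!o) with ha
  have has : a ∈ vertexStar s := starLink_mem_vertexStar s x.2 (!o)
  have hax : a ≠ x := by
    intro h
    have h2 : (fun p : Fin d × Bool => starLink s p.1 p.2) (x.2, !o) =
        (fun p : Fin d × Bool => starLink s p.1 p.2) (x.2, o) := by
      simp only; rw [← ha, h]; exact hxo
    have := starLink_injective hL1 s h2
    simp at this
  have hdir : x.2 = a.2 := by rw [ha, starLink_snd]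
  have hxa0 : (tInfluence x a : ℝ) = 0 := by
    rw [tInfluence_eq_jointPlaq hL1 hax, jointPlaq_eq_zero_of_vertexStar_of_snd_eq hL1 hx has hax.symm hdir,
      Nat.cast_zero]
  have haS : a ∈ (vertexStar s).erase x := mem_erase.2 ⟨hax, has⟩
  rw [← add_sum_erase _ _ haS, hxa0, zero_add]
  have hle : ∀ z ∈ ((vertexStar s).erase x).erase a, (tInfluence x z : ℝ) ≤ 1 := by
    intro z hz
    have hzx : z ≠ x := (mem_erase.1 (mem_erase.1 hz).2).1
    rw [tInfluence_eq_jointPlaq hL1 hzx]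
    exact_mod_cast jointPlaq_le_one hL hzx.symm
  have hcard : ((((vertexStar s).erase x).erase a).card : ℝ) = 2 * (d : ℝ) - 2 := by
    have h1 : (((vertexStar s).erase x).erase a).card + 2 = 2 * d := by
      rw [card_erase_of_mem haS, card_erase_of_mem hx, card_vertexStar hL1 s]
      have h2 : 2 ≤ (vertexStar s).card := Finset.one_lt_card.2 ⟨a, has, x, hx, hax⟩
      rw [card_vertexStar hL1 s] at h2
      omega
    have h1' : ((((vertexStar s).erase x).erase a).card : ℝ) + 2 = 2 * (d : ℝ) := by exact_mod_cast h1
    linarith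
  calc ∑ z ∈ ((vertexStar s).erase x).erase a, (tInfluence x z : ℝ)
      ≤ ∑ z ∈ ((vertexStar s).erase x).erase a, (1 : ℝ) := sum_le_sum hle
    _ = 2 * (d : ℝ) - 2 := by rw [sum_const, nsmul_eq_mul, mul_one, hcard]

/-! ### The robust influence matrix and the robust star array -/

/-- The robust influence matrix: `c · tInfluence x z + E x z`. [folklore] -/
def Cst (c : ℝ) (E : Edge d L → Edge d L → ℝ) (x z : Edge d L) : ℝ := c * (tInfluence x z : ℝ) + E x z

/-- The Neumann source of the boundary link `y` at the star of `s`: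
`wsrc x = E x y + ∑_{z ∈ ⋆∖x} E x z · Karr c s y z`. [folklore] -/
def wsrc (c : ℝ) (E : Edge d L → Edge d L → ℝ) (s : Site d L) (y x : Edge d L) : ℝ :=
  E x y + ∑ z ∈ (vertexStar s).erase x, E x z * Karr c s y z

/-- The `ℓ¹` size of the source over the star (the constant of the Neumann remainder). [folklore] -/
def Msrc (c : ℝ) (E : Edge d L → Edge d L → ℝ) (s : Site d L) (y : Edge d L) : ℝ :=
  ∑ x ∈ vertexStar s, wsrc c E s y x

/-- The Neumann correction of the boundary link `y`: `superSol` of the in-star matrix at depth `K` with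
row bound `θ`, source `wsrc` and remainder constant `2 Msrc`. [folklore] -/
def Uarr (c : ℝ) (E : Edge d L → Edge d L → ℝ) (θ : ℝ) (K : ℕ) (s : Site d L) (y x : Edge d L) : ℝ :=
  superSol (Cst c E) (vertexStar s) (wsrc c E s y) θ (2 * Msrc c E s y) K x

/-- **THE ROBUST STAR ARRAY** `Krob = Karr c + Uarr` (zero for `y` in the star). [folklore] -/
def Krob (c : ℝ) (E : Edge d L → Edge d L → ℝ) (θ : ℝ) (K : ℕ) (s : Site d L) (y x : Edge d L) : ℝ :=
  if y ∈ vertexStar s then 0 else Karr c s y x + Uarr c E θ K s y x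

variable {c θ lam : ℝ} {E : Edge d L → Edge d L → ℝ} {K : ℕ}

/-- `Cst ≥ 0`. [folklore] -/
theorem Cst_nonneg (hc : 0 ≤ c) (hE : ∀ x z, 0 ≤ E x z) (x z : Edge d L) : 0 ≤ Cst c E x z :=
  add_nonneg (mul_nonneg hc (Nat.cast_nonneg _)) (hE x z)

/-- `wsrc ≥ 0` below the pole. [folklore] -/
theorem wsrc_nonneg (hd : 2 ≤ d) (hc : 0 ≤ c) (hΔ : 0 < Delta d c) (hE : ∀ x z, 0 ≤ E x z) (s : Site d L)
    (y x : Edge d L) : 0 ≤ wsrc c E s y x :=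
  add_nonneg (hE x y) (sum_nonneg fun z _ => mul_nonneg (hE x z) (Karr_nonneg hd hc hΔ s y z))

/-- `wsrc ≤ Msrc` on the star. [folklore] -/
theorem wsrc_le_Msrc (hd : 2 ≤ d) (hc : 0 ≤ c) (hΔ : 0 < Delta d c) (hE : ∀ x z, 0 ≤ E x z) (s : Site d L)
    (y : Edge d L) {x : Edge d L} (hx : x ∈ vertexStar s) : wsrc c E s y x ≤ Msrc c E s y :=
  single_le_sum (f := fun x => wsrc c E s y x) (fun z _ => wsrc_nonneg hd hc hΔ hE s y z) hx

/-- `Msrc ≥ 0`. [folklore] -/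
theorem Msrc_nonneg (hd : 2 ≤ d) (hc : 0 ≤ c) (hΔ : 0 < Delta d c) (hE : ∀ x z, 0 ≤ E x z) (s : Site d L)
    (y : Edge d L) : 0 ≤ Msrc c E s y :=
  sum_nonneg fun x _ => wsrc_nonneg hd hc hΔ hE s y x

/-- `Uarr ≥ 0`. [folklore] -/
theorem Uarr_nonneg (hd : 2 ≤ d) (hc : 0 ≤ c) (hΔ : 0 < Delta d c) (hE : ∀ x z, 0 ≤ E x z) (hθ0 : 0 ≤ θ)
    (hθ1 : θ < 1) (K : ℕ) (s : Site d L) (y x : Edge d L) : 0 ≤ Uarr c E θ K s y x :=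
  superSol_nonneg (Cst_nonneg hc hE) (wsrc_nonneg hd hc hΔ hE s y) hθ0 hθ1
    (mul_nonneg zero_le_two (Msrc_nonneg hd hc hΔ hE s y)) K x

/-- `Krob ≥ 0`. [folklore] -/
theorem Krob_nonneg (hd : 2 ≤ d) (hc : 0 ≤ c) (hΔ : 0 < Delta d c) (hE : ∀ x z, 0 ≤ E x z) (hθ0 : 0 ≤ θ)
    (hθ1 : θ < 1) (K : ℕ) (s : Site d L) (y x : Edge d L) : 0 ≤ Krob c E θ K s y x := by
  unfold Krob
  split_ifs
  · exact le_rfl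
  · exact add_nonneg (Karr_nonneg hd hc hΔ s y x) (Uarr_nonneg hd hc hΔ hE hθ0 hθ1 K s y x)

/-- `Uarr` vanishes off the star. [folklore] -/
theorem Uarr_of_not_mem (s : Site d L) (y : Edge d L) {x : Edge d L} (hx : x ∉ vertexStar s) :
    Uarr c E θ K s y x = 0 :=
  superSol_of_not_mem _ _ _ _ _ hx

/-! ### Support of the robust array -/

/-- If the source and its constant vanish, the Neumann correction vanishes. [folklore] -/
theorem Uarr_eq_zero_of_wsrc_eq_zero {s : Site d L} {y : Edge d L} (h : ∀ x ∈ vertexStar s, wsrc c E s y x = 0)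
    (x : Edge d L) : Uarr c E θ K s y x = 0 := by
  unfold Uarr
  by_cases hx : x ∈ vertexStar s
  · rw [superSol_of_mem _ _ _ _ _ hx]
    have hM : Msrc c E s y = 0 := sum_eq_zero h
    have hiter : ∀ (k : ℕ) (z : Edge d L), iter (Cst c E) (vertexStar s) (wsrc c E s y) k z = 0 := by
      intro k
      induction k with
      | zero => intro z; rfl
      | succ k ih =>
        intro z
        by_cases hz : z ∈ vertexStar s
        · rw [iter_succ_of_mem _ _ _ hz, h z hz]; simp [ih]
        · exact iter_of_not_mem _ _ _ hz
    rw [hiter, hM]; simp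
  · exact superSol_of_not_mem _ _ _ _ _ hx

/-- **Support of the robust array**: if `Krob c E θ K s y x ≠ 0` then `y` lies on the star boundary of `s`
or some star link `x'` has a nonzero off-column entry `E x' y`. [folklore] -/
theorem mem_starBoundary_or_of_Krob_ne_zero {s : Site d L} {y x : Edge d L}
    (h : Krob c E θ K s y x ≠ 0) : y ∈ starBoundary s ∨ ∃ x' ∈ vertexStar s, E x' y ≠ 0 := by
  by_contra hcon
  rw [not_or, not_exists] at hcon
  obtain ⟨hyb, hE0⟩ := hcon
  have hE0' : ∀ x' ∈ vertexStar s, E x' y = 0 := fun x' hx' => by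
    by_contra h'; exact hE0 x' ⟨hx', h'⟩
  apply h
  unfold Krob
  split_ifs with hy
  · rfl
  · rw [Karr_eq_zero_of_not_mem_starBoundary hyb x, zero_add]
    refine Uarr_eq_zero_of_wsrc_eq_zero (fun x' hx' => ?_) x
    unfold wsrc
    rw [hE0' x' hx', zero_add]
    exact sum_eq_zero fun z _ => by rw [Karr_eq_zero_of_not_mem_starBoundary hyb z, mul_zero]

/-! ### The in-star row bound and the domination `c · kside ≤ 2 Karr` -/

/-- **In-star row of the robust matrix**: `∑_{z ∈ ⋆∖x} (c · tInfluence x z + E x z) ≤ (2d−2)c + λ` for a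
star link `x`, whenever the off-column rows are `≤ λ` (`∑_{z ≠ x} E x z ≤ λ`). [folklore] -/
theorem sum_star_erase_Cst_le (hL : 3 ≤ L) (hc : 0 ≤ c) (hE : ∀ x z, 0 ≤ E x z)
    (hlam : ∀ x, ∑ z ∈ univ.erase x, E x z ≤ lam) {s : Site d L} {x : Edge d L} (hx : x ∈ vertexStar s) :
    ∑ z ∈ (vertexStar s).erase x, Cst c E x z ≤ (2 * (d : ℝ) - 2) * c + lam := by
  unfold Cst
  rw [sum_add_distrib, ← mul_sum]
  refine add_le_add ?_ ?_
  · rw [mul_comm]; exact mul_le_mul_of_nonneg_right (sum_star_erase_tInfluence_le hL hx) hc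
  · exact (sum_le_sum_of_subset_of_nonneg (erase_subset_erase _ (subset_univ _)) fun z _ _ => hE x z).trans
      (hlam x)

/-- **Domination of the one-sided array by the array**: for a star plaquette `q ∋ y` off the star with star
links `a ≠ b` on `q`, `c · kside c s a b x ≤ 2 · Karr c s y x` for every star link `x` (all terms of `Karr`
are nonnegative and `(a, b)` is one of its pairs). [folklore] -/
theorem c_mul_kside_le_two_mul_Karr (hd : 2 ≤ d) (hc : 0 ≤ c) (hΔ : 0 < Delta d c) {s : Site d L}
    {q : Plaquette d L} (hq : q ∈ starPlaqs s) {y : Edge d L} (hyq : y ∈ plaqEdgesT q) (hy : y ∉ vertexStar s)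
    {a b : Edge d L} (ha : a ∈ vertexStar s) (haq : a ∈ plaqEdgesT q) (hb : b ∈ vertexStar s)
    (hbq : b ∈ plaqEdgesT q) (hab : a ≠ b) {x : Edge d L} (hx : x ∈ vertexStar s) :
    c * kside c s a b x ≤ 2 * Karr c s y x := by
  have hKx : Karr c s y x = (c / 2) *
      ∑ q' ∈ (starPlaqs s).filter (fun q' => y ∈ plaqEdgesT q'), ∑ ab ∈ starPairsOf s q', kside c s ab.1 ab.2 x := by
    simp only [Karr, if_pos (And.intro hx hy)]
  rw [hKx]
  have hqmem : q ∈ (starPlaqs s).filter (fun q' => y ∈ plaqEdgesT q') := mem_filter.2 ⟨hq, hyq⟩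
  have habmem : (a, b) ∈ starPairsOf s q := mem_starPairsOf.2 ⟨⟨haq, ha⟩, ⟨hbq, hb⟩, hab⟩
  have hinner : kside c s a b x ≤ ∑ ab ∈ starPairsOf s q, kside c s ab.1 ab.2 x :=
    single_le_sum (f := fun ab : Edge d L × Edge d L => kside c s ab.1 ab.2 x)
      (fun ab _ => kside_nonneg hd hc hΔ s _ _ _) habmem
  have houter : ∑ ab ∈ starPairsOf s q, kside c s ab.1 ab.2 x ≤
      ∑ q' ∈ (starPlaqs s).filter (fun q' => y ∈ plaqEdgesT q'), ∑ ab ∈ starPairsOf s q', kside c s ab.1 ab.2 x :=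
    single_le_sum (f := fun q' => ∑ ab ∈ starPairsOf s q', kside c s ab.1 ab.2 x)
      (fun q' _ => sum_nonneg fun ab _ => kside_nonneg hd hc hΔ s _ _ _) hqmem
  nlinarith [hinner.trans houter]

/-! ### The one-sided Neumann sources and the averaging lemma -/

/-- The ONE-SIDED Neumann source of the boundary link `y` with the gauge fixed at `a`, partner `b`:
`wone x = ∑_{z ≠ x} E x z · dvec c s y a b z = E x y + ∑_{z ∈ ⋆∖x} E x z · c · kside c s a b z`. [folklore] -/
def wone (c : ℝ) (E : Edge d L → Edge d L → ℝ) (s : Site d L) (y a b x : Edge d L) : ℝ :=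
  ∑ z ∈ univ.erase x, E x z * dvec c s y a b z

/-- The one-sided source in star form: `wone x = E x y + ∑_{z ∈ ⋆∖x} E x z · (c · kside c s a b z)` for
`y` off the star. [folklore] -/
theorem wone_eq {s : Site d L} {y : Edge d L} (hy : y ∉ vertexStar s) (a b : Edge d L) {x : Edge d L}
    (hxy : x ≠ y) :
    wone c E s y a b x = E x y + ∑ z ∈ (vertexStar s).erase x, E x z * (c * kside c s a b z) := by
  unfold wone
  have hyx : y ∈ univ.erase x := mem_erase.2 ⟨hxy.symm, mem_univ _⟩
  rw [← add_sum_erase _ _ hyx]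
  have hdy : dvec c s y a b y = 1 := by simp [dvec]
  rw [hdy, mul_one]
  congr 1
  have hstar : ∑ z ∈ (vertexStar s).erase x, E x z * (c * kside c s a b z) =
      ∑ z ∈ (vertexStar s).erase x, E x z * dvec c s y a b z :=
    sum_congr rfl fun z hz => by
      obtain ⟨-, hzs⟩ := mem_erase.1 hz
      have hzy : z ≠ y := fun h => hy (h ▸ hzs)
      simp only [dvec, if_neg hzy, if_pos hzs]
  rw [hstar]
  symm
  refine sum_subset (fun z hz => ?_) (fun z hz hz' => ?_)
  · obtain ⟨hzx, hzs⟩ := mem_erase.1 hz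
    exact mem_erase.2 ⟨fun h => hy (h ▸ hzs), mem_erase.2 ⟨hzx, mem_univ _⟩⟩
  · obtain ⟨hzy, hz2⟩ := mem_erase.1 hz
    have hzs : z ∉ vertexStar s := fun h => hz' (mem_erase.2 ⟨(mem_erase.1 hz2).1, h⟩)
    simp only [dvec, if_neg hzy, if_neg hzs, mul_zero]

/-- `wone ≥ 0` below the pole. [folklore] -/
theorem wone_nonneg (hd : 2 ≤ d) (hc : 0 ≤ c) (hΔ : 0 < Delta d c) (hE : ∀ x z, 0 ≤ E x z) (s : Site d L)
    (y a b x : Edge d L) : 0 ≤ wone c E s y a b x :=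
  sum_nonneg fun z _ => mul_nonneg (hE x z) (dvec_nonneg hd hc hΔ s y a b z)

/-- **One-sided source below twice the array source**: `wone ≤ 2 wsrc` on the star (`c · kside ≤ 2 Karr`).
[folklore] -/
theorem wone_le_two_mul_wsrc (hd : 2 ≤ d) (hc : 0 ≤ c) (hΔ : 0 < Delta d c) (hE : ∀ x z, 0 ≤ E x z)
    {s : Site d L} {q : Plaquette d L} (hq : q ∈ starPlaqs s) {y : Edge d L} (hyq : y ∈ plaqEdgesT q)
    (hy : y ∉ vertexStar s) {a b : Edge d L} (ha : a ∈ vertexStar s) (haq : a ∈ plaqEdgesT q)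
    (hb : b ∈ vertexStar s) (hbq : b ∈ plaqEdgesT q) (hab : a ≠ b) {x : Edge d L} (hx : x ∈ vertexStar s) :
    wone c E s y a b x ≤ 2 * wsrc c E s y x := by
  have hxy : x ≠ y := fun h => hy (h ▸ hx)
  rw [wone_eq hy a b hxy]
  unfold wsrc
  rw [mul_add, mul_sum]
  refine add_le_add (by nlinarith [hE x y]) (sum_le_sum fun z hz => ?_)
  have hzs : z ∈ vertexStar s := (mem_erase.1 hz).2
  have h := c_mul_kside_le_two_mul_Karr hd hc hΔ hq hyq hy ha haq hb hbq hab hzs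
  calc E x z * (c * kside c s a b z) ≤ E x z * (2 * Karr c s y z) := mul_le_mul_of_nonneg_left h (hE x z)
    _ = 2 * (E x z * Karr c s y z) := by ring

/-- **The mean of the two one-sided sources is below the array source**:
`(wone a b + wone b a)/2 ≤ wsrc` on the star. [folklore] -/
theorem wone_add_wone_le (hd : 2 ≤ d) (hc : 0 ≤ c) (hΔ : 0 < Delta d c) (hE : ∀ x z, 0 ≤ E x z)
    {s : Site d L} {q : Plaquette d L} (hq : q ∈ starPlaqs s) {y : Edge d L} (hyq : y ∈ plaqEdgesT q)
    (hy : y ∉ vertexStar s) {a b : Edge d L} (ha : a ∈ vertexStar s) (haq : a ∈ plaqEdgesT q)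
    (hb : b ∈ vertexStar s) (hbq : b ∈ plaqEdgesT q) (hab : a ≠ b) {x : Edge d L} (hx : x ∈ vertexStar s) :
    (wone c E s y a b x + wone c E s y b a x) / 2 ≤ wsrc c E s y x := by
  have hxy : x ≠ y := fun h => hy (h ▸ hx)
  rw [wone_eq hy a b hxy, wone_eq hy b a hxy]
  unfold wsrc
  have hpair : ∀ z ∈ (vertexStar s).erase x, (c * kside c s a b z + c * kside c s b a z) / 2 ≤ Karr c s y z := by
    intro z hz
    have hzs : z ∈ vertexStar s := (mem_erase.1 hz).2
    have hKz : Karr c s y z = (c / 2) *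
        ∑ q' ∈ (starPlaqs s).filter (fun q' => y ∈ plaqEdgesT q'),
          ∑ ab ∈ starPairsOf s q', kside c s ab.1 ab.2 z := by
      simp only [Karr, if_pos (And.intro hzs hy)]
    rw [hKz]
    have hqmem : q ∈ (starPlaqs s).filter (fun q' => y ∈ plaqEdgesT q') := mem_filter.2 ⟨hq, hyq⟩
    have hsub : ({(a, b), (b, a)} : Finset (Edge d L × Edge d L)) ⊆ starPairsOf s q := by
      intro p hp
      simp only [mem_insert, mem_singleton] at hp
      rcases hp with rfl | rfl
      · exact mem_starPairsOf.2 ⟨⟨haq, ha⟩, ⟨hbq, hb⟩, hab⟩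
      · exact mem_starPairsOf.2 ⟨⟨hbq, hb⟩, ⟨haq, ha⟩, hab.symm⟩
    have hinner : kside c s a b z + kside c s b a z ≤ ∑ ab ∈ starPairsOf s q, kside c s ab.1 ab.2 z := by
      have hne : (a, b) ≠ (b, a) := fun h => hab (Prod.mk.inj h).1
      calc kside c s a b z + kside c s b a z
          = ∑ ab ∈ ({(a, b), (b, a)} : Finset (Edge d L × Edge d L)), kside c s ab.1 ab.2 z := by
            rw [sum_pair hne]
        _ ≤ _ := sum_le_sum_of_subset_of_nonneg hsub fun ab _ _ => kside_nonneg hd hc hΔ s _ _ _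
    have houter : ∑ ab ∈ starPairsOf s q, kside c s ab.1 ab.2 z ≤
        ∑ q' ∈ (starPlaqs s).filter (fun q' => y ∈ plaqEdgesT q'),
          ∑ ab ∈ starPairsOf s q', kside c s ab.1 ab.2 z :=
      single_le_sum (f := fun q' => ∑ ab ∈ starPairsOf s q', kside c s ab.1 ab.2 z)
        (fun q' _ => sum_nonneg fun ab _ => kside_nonneg hd hc hΔ s _ _ _) hqmem
    nlinarith [hinner.trans houter]
  have hsum : (∑ z ∈ (vertexStar s).erase x, E x z * (c * kside c s a b z) +
      ∑ z ∈ (vertexStar s).erase x, E x z * (c * kside c s b a z)) / 2 ≤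
        ∑ z ∈ (vertexStar s).erase x, E x z * Karr c s y z := by
    rw [← sum_add_distrib, Finset.sum_div]
    refine sum_le_sum fun z hz => ?_
    have h := mul_le_mul_of_nonneg_left (hpair z hz) (hE x z)
    refine le_trans (le_of_eq ?_) h
    ring
  linarith

/-- Monotonicity of the Neumann iterates in the source, with the comparison required ON `S` ONLY (the
iterates never read the source off `S`). [folklore] -/
theorem iter_mono_on {ι : Type*} [DecidableEq ι] {C : ι → ι → ℝ} {S : Finset ι} {w w' : ι → ℝ}
    (hC : ∀ x z, 0 ≤ C x z) (hww' : ∀ x ∈ S, w x ≤ w' x) :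
    ∀ (k : ℕ) (x : ι), iter C S w k x ≤ iter C S w' k x
  | 0, _ => le_rfl
  | k + 1, x => by
    by_cases hx : x ∈ S
    · rw [iter_succ_of_mem C w k hx, iter_succ_of_mem C w' k hx]
      exact add_le_add (hww' x hx)
        (sum_le_sum fun z _ => mul_le_mul_of_nonneg_left (iter_mono_on hC hww' k z) (hC x z))
    · rw [iter_of_not_mem C w _ hx, iter_of_not_mem C w' _ hx]

/-- **THE AVERAGING LEMMA**: the mean of the two one-sided Neumann corrections (gauge fixed at `a`, resp.
at `b`; both with remainder constant `2 Msrc`) is below the correction `Uarr` of the array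
(additivity, scaling and monotonicity of the Neumann iterates in the source). [folklore] -/
theorem superSol_wone_avg_le_Uarr (hd : 2 ≤ d) (hc : 0 ≤ c) (hΔ : 0 < Delta d c) (hE : ∀ x z, 0 ≤ E x z)
    {s : Site d L} {q : Plaquette d L} (hq : q ∈ starPlaqs s) {y : Edge d L}
    (hyq : y ∈ plaqEdgesT q) (hy : y ∉ vertexStar s) {a b : Edge d L} (ha : a ∈ vertexStar s)
    (haq : a ∈ plaqEdgesT q) (hb : b ∈ vertexStar s) (hbq : b ∈ plaqEdgesT q) (hab : a ≠ b) (K : ℕ)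
    (x : Edge d L) :
    (superSol (Cst c E) (vertexStar s) (wone c E s y a b) θ (2 * Msrc c E s y) K x +
        superSol (Cst c E) (vertexStar s) (wone c E s y b a) θ (2 * Msrc c E s y) K x) / 2 ≤
      Uarr c E θ K s y x := by
  unfold Uarr
  by_cases hx : x ∈ vertexStar s
  · rw [superSol_of_mem _ _ _ _ _ hx, superSol_of_mem _ _ _ _ _ hx, superSol_of_mem _ _ _ _ _ hx]
    have havg : (iter (Cst c E) (vertexStar s) (wone c E s y a b) K x +
        iter (Cst c E) (vertexStar s) (wone c E s y b a) K x) / 2 =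
          iter (Cst c E) (vertexStar s) (fun z => (1 / 2) * (wone c E s y a b z + wone c E s y b a z)) K x := by
      rw [iter_smul, iter_add]; ring
    have hmono : iter (Cst c E) (vertexStar s) (fun z => (1 / 2) * (wone c E s y a b z + wone c E s y b a z)) K x
        ≤ iter (Cst c E) (vertexStar s) (wsrc c E s y) K x := by
      refine iter_mono_on (Cst_nonneg hc hE) (fun z hz => ?_) K x
      have h := wone_add_wone_le hd hc hΔ hE hq hyq hy ha haq hb hbq hab hz
      linarith
    calc (iter (Cst c E) (vertexStar s) (wone c E s y a b) K x + θ ^ K * (2 * Msrc c E s y) / (1 - θ) +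
          (iter (Cst c E) (vertexStar s) (wone c E s y b a) K x + θ ^ K * (2 * Msrc c E s y) / (1 - θ))) / 2
        = (iter (Cst c E) (vertexStar s) (wone c E s y a b) K x +
            iter (Cst c E) (vertexStar s) (wone c E s y b a) K x) / 2 + θ ^ K * (2 * Msrc c E s y) / (1 - θ) := by
          ring
      _ ≤ iter (Cst c E) (vertexStar s) (wsrc c E s y) K x + θ ^ K * (2 * Msrc c E s y) / (1 - θ) := by
          rw [havg]; exact add_le_add hmono le_rfl
  · rw [superSol_of_not_mem _ _ _ _ _ hx, superSol_of_not_mem _ _ _ _ _ hx, superSol_of_not_mem _ _ _ _ _ hx]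
    simp

end Summit.Ventures.YMGap.RobustStar

end
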